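import Summits.AtomisticToContinuum.Crystallization.Theses.IsometryAtoms
import Summits.AtomisticToContinuum.Crystallization.Theorems.PricedLinkCensusLocalToGlobalPhaseGapDefs

/-!
# Negative knowledge for crux `MinimisingLawsCohesive` (stmt-AtomisticToContinuum-15777), I:
# one-point mixtures — the energy threshold `e*` is sharp, and the crux contains Palm-side
# stability

Crux-attack (vetting) unit `rattack-stmt-AtomisticToContinuum-15777`
(`--supports stmt-AtomisticToContinuum-15777`).  The crux `IsometryAtoms.MinimisingLawsCohesive`
says: for every hard core `δ > 0` and every probability law `P` on rooted configurations of `ℝ³`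
that is a.s. `IsRootedHardCore δ`, `IsPointStationaryLaw` (Mecke identity) and MINIMISING
(`∫ rootEnergy V_LJ dP ≤ e* := ⨅_Q e_LJ(Q)`), `P`-a.s. the configuration is relatively dense.

The cheapest structural attack is the MIXTURE with the one-point law `δ_{δ_0}` (the configuration
consisting of the root alone): `δ_{δ_0}` is point-stationary (`isPointStationaryLaw_dirac_dirac_zero`),
`δ`-hard-core for every `δ`, has root energy `0`, and is NOT relatively dense; the point-stationary
laws form a convex cone, so `P_p := (1 - p) • P + p • δ_{δ_0}` keeps the whole frame, has mean root
energy `(1 - p) · E_P[rootEnergy]` (`integral_rootEnergy_mix`), and violates the conclusion for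
every `p ≠ 0` (`not_ae_relDense_mix`).  Consequences (all `[folklore]`):

* `not_cohesive_at_relaxed_threshold` — **the threshold is sharp**: for every `e > e*` the crux
  with `∫ rootEnergy ≤ e` in place of `≤ e*` is FALSE (mix the Benjamini–Schramm limit law of
  ground states, whose mean root energy is exactly `e*` — `exists_minimising_law`, from the tree
  theorems `benjaminiSchrammLimit_proof` and `crysEnergyLimit` — with a little of `δ_{δ_0}`).  Any
  proof must use the exact value `e*`; no argument stable under small energy perturbations of the
  law can work.
* `not_cohesive_without_energy` — the energy hypothesis is load-bearing (witness `δ_{δ_0}`).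
* `eStar_le_integral_of_minimisingLawsCohesive` — **the crux implies Palm-side stability**: `e* ≤
  E_P[rootEnergy]` for EVERY point-stationary a.s.-hard-core probability law (else a mixture with
  `δ_{δ_0}` is minimising and charges the one-point configuration).  Hence
  `minimisingLawsCohesive_iff_stable_and_exact`: the crux is EXACTLY "Palm stability ∧ cohesion of
  the laws with `E_P[rootEnergy] = e*`"; a counterexample must sit exactly at `e*`.
* `integrable_of_integral_le_eStar` — the Bochner junk value cannot enter: a law satisfying the
  energy hypothesis has `rootEnergy` integrable (`0 ≤ e*` is false, `eStar_le_neg`).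
* `exists_minimising_law` — non-vacuity of the frame (hard-core a.s., point-stationary,
  probability, `∫ rootEnergy = e*`).
(Part II, `RootedComb.lean`: point-stationarity is load-bearing.)
-/

noncomputable section

namespace Summit.AtomisticToContinuum.Crystallization.Theorems.MinimisingLawsCohesive.Negative.OnePointMixtures

open MeasureTheory Set Filter
open scoped ENNReal Topology
open Literature.MathematicalPhysics.StatisticalMechanics Literature.Probability.Process
open Summit.AtomisticToContinuum.Crystallization.Theses.IsometryAtoms (MinimisingLawsCohesive)
open Summit.AtomisticToContinuum.Crystallization.Theorems.ChargedEnergyGapNegative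
  (eStar eStar_le bddBelow_energyPerParticle_lennardJones crysEnergyLimit)
open Summit.AtomisticToContinuum.Crystallization.Theorems.PricedLinkCensusLocalToGlobalPhaseGap
  (eStar_le_neg)

/-! ## §1 The one-point configuration is not relatively dense -/

/-- The configuration `δ_0` (the root alone) is not relatively dense: its only point is `0`.
[folklore] -/
theorem not_relDense_dirac_zero :
    ¬ ∃ R₀ : ℝ, ∀ z : EuclideanSpace ℝ (Fin 3), ∃ y : EuclideanSpace ℝ (Fin 3),
      (Measure.dirac (0 : EuclideanSpace ℝ (Fin 3))) {y} ≠ 0 ∧ dist z y ≤ R₀ := by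
  rintro ⟨R₀, h⟩
  obtain ⟨y, hy, hz⟩ := h (EuclideanSpace.single 0 (|R₀| + 1))
  have hy0 : y = 0 := by
    by_contra hne
    apply hy
    rw [Measure.dirac_apply' _ (measurableSet_singleton y)]
    simp [Ne.symm hne]
  subst hy0
  rw [dist_zero_right, PiLp.norm_single, Real.norm_eq_abs,
    abs_of_pos (by positivity : 0 < |R₀| + 1)] at hz
  linarith [le_abs_self R₀]

/-- Under a one-point mixture with `p ≠ 0` the conclusion of the crux fails: the atom `δ_0` is
charged and is not relatively dense (outer-measure bound `Measure.le_dirac_apply`, no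
measurability needed). [folklore] -/
theorem not_ae_relDense_mix (P : Measure (Measure (EuclideanSpace ℝ (Fin 3)))) {p : ℝ≥0∞}
    (hp : p ≠ 0) :
    ¬ ∀ᵐ μ ∂((1 - p) • P + p • Measure.dirac (Measure.dirac (0 : EuclideanSpace ℝ (Fin 3)))),
      ∃ R₀ : ℝ, ∀ z : EuclideanSpace ℝ (Fin 3), ∃ y : EuclideanSpace ℝ (Fin 3),
        μ {y} ≠ 0 ∧ dist z y ≤ R₀ := by
  intro h
  rw [ae_iff] at h
  set s : Set (Measure (EuclideanSpace ℝ (Fin 3))) :=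
    {μ | ¬ ∃ R₀ : ℝ, ∀ z : EuclideanSpace ℝ (Fin 3), ∃ y : EuclideanSpace ℝ (Fin 3),
      μ {y} ≠ 0 ∧ dist z y ≤ R₀} with hs
  have hmem : Measure.dirac (0 : EuclideanSpace ℝ (Fin 3)) ∈ s := not_relDense_dirac_zero
  have h1 : (1 : ℝ≥0∞) ≤ Measure.dirac (Measure.dirac (0 : EuclideanSpace ℝ (Fin 3))) s := by
    refine le_trans (le_of_eq ?_) Measure.le_dirac_apply
    rw [indicator_of_mem hmem, Pi.one_apply]
  have h2 : p ≤
      ((1 - p) • P + p • Measure.dirac (Measure.dirac (0 : EuclideanSpace ℝ (Fin 3)))) s := by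
    rw [Measure.add_apply, Measure.smul_apply, Measure.smul_apply, smul_eq_mul, smul_eq_mul]
    calc p = p * 1 := (mul_one p).symm
      _ ≤ p * Measure.dirac (Measure.dirac (0 : EuclideanSpace ℝ (Fin 3))) s := by gcongr
      _ ≤ _ := le_add_self
  rw [h] at h2
  exact hp (nonpos_iff_eq_zero.1 h2)

/-! ## §2 One-point mixtures keep the frame -/

/-- A one-point mixture of a probability law is a probability law (`p ≤ 1`). [folklore] -/
theorem isProbabilityMeasure_mix (P : Measure (Measure (EuclideanSpace ℝ (Fin 3))))
    [IsProbabilityMeasure P] {p : ℝ≥0∞} (hp : p ≤ 1) :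
    IsProbabilityMeasure
      ((1 - p) • P + p • Measure.dirac (Measure.dirac (0 : EuclideanSpace ℝ (Fin 3)))) := by
  constructor
  rw [Measure.add_apply, Measure.smul_apply, Measure.smul_apply, measure_univ, measure_univ,
    smul_eq_mul, smul_eq_mul, mul_one, mul_one, tsub_add_cancel_of_le hp]

/-- A one-point mixture of an a.s. `δ`-hard-core law is a.s. `δ`-hard-core (`δ_0` is hard-core
for every `δ`). [folklore] -/
theorem ae_isRootedHardCore_mix {δ : ℝ} {P : Measure (Measure (EuclideanSpace ℝ (Fin 3)))}
    (h : ∀ᵐ μ ∂P, IsRootedHardCore δ μ) (p : ℝ≥0∞) :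
    ∀ᵐ μ ∂((1 - p) • P + p • Measure.dirac (Measure.dirac (0 : EuclideanSpace ℝ (Fin 3)))),
      IsRootedHardCore δ μ := by
  rw [ae_add_measure_iff]
  refine ⟨Measure.ae_smul_measure h _, Measure.ae_smul_measure ?_ _⟩
  exact (ae_dirac_dirac_zero (measurableSet_singleton (0 : EuclideanSpace ℝ (Fin 3)))).mono
    fun μ hμ => hμ ▸ isRootedHardCore_dirac_zero δ

/-- A one-point mixture of a point-stationary law is point-stationary (the point-stationary laws
form a convex cone containing `δ_{δ_0}`). [folklore] -/
theorem isPointStationaryLaw_mix {P : Measure (Measure (EuclideanSpace ℝ (Fin 3)))}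
    (h : IsPointStationaryLaw P) (p : ℝ≥0∞) :
    IsPointStationaryLaw
      ((1 - p) • P + p • Measure.dirac (Measure.dirac (0 : EuclideanSpace ℝ (Fin 3)))) :=
  (h.smul (1 - p)).add (isPointStationaryLaw_dirac_dirac_zero.smul p)

/-- The root energy vanishes a.s. under `δ_{δ_0}` (`V_LJ(0) = 0` by `0⁻¹ = 0`). [folklore] -/
theorem rootEnergy_ae_eq_zero_dirac :
    (fun μ : Measure (EuclideanSpace ℝ (Fin 3)) => rootEnergy lennardJones μ)
      =ᵐ[Measure.dirac (Measure.dirac (0 : EuclideanSpace ℝ (Fin 3)))] fun _ => (0 : ℝ) := by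
  filter_upwards [ae_dirac_dirac_zero (measurableSet_singleton (0 : EuclideanSpace ℝ (Fin 3)))]
    with μ hμ
  rw [hμ, rootEnergy_dirac, norm_zero, lennardJones_zero, zero_div]

/-- **Mean root energy of a one-point mixture**:
`E_{P_p}[rootEnergy] = (1 - p) · E_P[rootEnergy]` (both sides take the Bochner junk value
together). [folklore] -/
theorem integral_rootEnergy_mix (P : Measure (Measure (EuclideanSpace ℝ (Fin 3)))) (p : ℝ≥0∞) :
    ∫ μ, rootEnergy lennardJones μ
        ∂((1 - p) • P + p • Measure.dirac (Measure.dirac (0 : EuclideanSpace ℝ (Fin 3)))) =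
      (1 - p).toReal * ∫ μ, rootEnergy lennardJones μ ∂P := by
  have hdirac :
      Integrable (fun μ : Measure (EuclideanSpace ℝ (Fin 3)) => rootEnergy lennardJones μ)
        (p • Measure.dirac (Measure.dirac (0 : EuclideanSpace ℝ (Fin 3)))) :=
    (integrable_congr (Measure.ae_smul_measure rootEnergy_ae_eq_zero_dirac p)).2
      (integrable_zero _ _ _)
  have hdirac0 : ∫ μ, rootEnergy lennardJones μ
      ∂(p • Measure.dirac (Measure.dirac (0 : EuclideanSpace ℝ (Fin 3)))) = 0 := by
    rw [integral_smul_measure, integral_congr_ae rootEnergy_ae_eq_zero_dirac, integral_zero,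
      smul_zero]
  have htop : (1 - p) ≠ ∞ := ne_top_of_le_ne_top ENNReal.one_ne_top tsub_le_self
  by_cases hint :
      Integrable (fun μ : Measure (EuclideanSpace ℝ (Fin 3)) => rootEnergy lennardJones μ) P
  · rw [integral_add_measure (hint.smul_measure htop) hdirac, integral_smul_measure, hdirac0,
      add_zero, smul_eq_mul]
  · by_cases h0 : 1 - p = 0
    · rw [h0, zero_smul, zero_add, hdirac0, ENNReal.toReal_zero, zero_mul]
    · have hni : ¬ Integrable
          (fun μ : Measure (EuclideanSpace ℝ (Fin 3)) => rootEnergy lennardJones μ)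
          ((1 - p) • P + p • Measure.dirac (Measure.dirac (0 : EuclideanSpace ℝ (Fin 3)))) := by
        intro hi
        exact hint ((integrable_smul_measure h0 htop).1
          (hi.mono_measure (Measure.le_add_right le_rfl)))
      rw [integral_undef hni, integral_undef hint, mul_zero]

/-! ## §3 Non-vacuity: a minimising law exists -/

/-- **The frame of the crux is inhabited, at energy exactly `e*`**: the Benjamini–Schramm limit
law of Lennard-Jones ground states (tree theorem `benjaminiSchrammLimit_proof`, item 9230) is a
probability law, a.s. hard-core, point-stationary, with mean root energy `lim E(N)/N = e*`
(`crysEnergyLimit`, item 0626). [folklore] -/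
theorem exists_minimising_law :
    ∃ δ : ℝ, 0 < δ ∧ ∃ P : Measure (Measure (EuclideanSpace ℝ (Fin 3))),
      IsProbabilityMeasure P ∧ (∀ᵐ μ ∂P, IsRootedHardCore δ μ) ∧ IsPointStationaryLaw P ∧
      ∫ μ, rootEnergy lennardJones μ ∂P = eStar := by
  choose x hx using
    (show ∀ N : ℕ, ∃ y : Fin N → EuclideanSpace ℝ (Fin 3), IsGroundState lennardJones y from
      LennardJonesGroundStatesExist_holds)
  obtain ⟨φ, hφ, δ, hδ, P, hP, hhc, hst, htend, -⟩ :=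
    Summit.AtomisticToContinuum.Crystallization.Theorems.benjaminiSchrammLimit_proof x hx
  refine ⟨δ, hδ, P, hP, hhc, hst, ?_⟩
  exact tendsto_nhds_unique htend (crysEnergyLimit.comp hφ.tendsto_atTop)

/-- A law satisfying the energy hypothesis has an integrable root energy: the Bochner junk value
`0` is not `≤ e* < 0`. [folklore] -/
theorem integrable_of_integral_le_eStar {P : Measure (Measure (EuclideanSpace ℝ (Fin 3)))}
    (h : ∫ μ, rootEnergy lennardJones μ ∂P ≤ eStar) :
    Integrable (fun μ : Measure (EuclideanSpace ℝ (Fin 3)) => rootEnergy lennardJones μ) P := by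
  by_contra hni
  rw [integral_undef hni] at h
  linarith [eStar_le_neg]

/-! ## §4 The threshold is sharp; the energy hypothesis is load-bearing -/

/-- **The energy threshold of the crux is sharp.** For every `e > e*`, the crux with the
minimising hypothesis relaxed to `∫ rootEnergy ≤ e` is FALSE: mix the minimising law of
`exists_minimising_law` with weight `p = min 1 ((e - e*)/(-e*)) > 0` of `δ_{δ_0}`. [folklore] -/
theorem not_cohesive_at_relaxed_threshold {e : ℝ} (he : eStar < e) :
    ¬ (∀ δ : ℝ, 0 < δ → ∀ P : Measure (Measure (EuclideanSpace ℝ (Fin 3))),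
        IsProbabilityMeasure P → (∀ᵐ μ ∂P, IsRootedHardCore δ μ) → IsPointStationaryLaw P →
        (∫ μ, rootEnergy lennardJones μ ∂P) ≤ e →
        ∀ᵐ μ ∂P, ∃ R₀ : ℝ, ∀ z : EuclideanSpace ℝ (Fin 3), ∃ y : EuclideanSpace ℝ (Fin 3),
          μ {y} ≠ 0 ∧ dist z y ≤ R₀) := by
  intro H
  obtain ⟨δ, hδ, P, hP, hhc, hst, hE⟩ := exists_minimising_law
  have hes : eStar < 0 := by linarith [eStar_le_neg]
  set r : ℝ := min 1 ((e - eStar) / (-eStar)) with hr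
  have hr0 : 0 < r := lt_min one_pos (div_pos (by linarith) (by linarith))
  have hr1 : r ≤ 1 := min_le_left _ _
  set p : ℝ≥0∞ := ENNReal.ofReal r with hpdef
  have hp1 : p ≤ 1 := ENNReal.ofReal_le_one.2 hr1
  have hp0 : p ≠ 0 := (ENNReal.ofReal_pos.2 hr0).ne'
  have htoReal : (1 - p).toReal = 1 - r := by
    rw [ENNReal.toReal_sub_of_le hp1 ENNReal.one_ne_top, ENNReal.toReal_one, hpdef,
      ENNReal.toReal_ofReal hr0.le]
  haveI := isProbabilityMeasure_mix P hp1
  refine not_ae_relDense_mix P hp0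
    (H δ hδ _ inferInstance (ae_isRootedHardCore_mix hhc p) (isPointStationaryLaw_mix hst p) ?_)
  rw [integral_rootEnergy_mix, htoReal, hE]
  have hr2 : r * (-eStar) ≤ e - eStar := by
    have := min_le_right 1 ((e - eStar) / (-eStar))
    rwa [← hr, le_div_iff₀ (by linarith)] at this
  nlinarith

/-- **The energy hypothesis is load-bearing**: without it the crux is false (the one-point law
`δ_{δ_0}` is a point-stationary hard-core probability law that is not relatively dense).
[folklore] -/
theorem not_cohesive_without_energy :
    ¬ (∀ δ : ℝ, 0 < δ → ∀ P : Measure (Measure (EuclideanSpace ℝ (Fin 3))),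
        IsProbabilityMeasure P → (∀ᵐ μ ∂P, IsRootedHardCore δ μ) → IsPointStationaryLaw P →
        ∀ᵐ μ ∂P, ∃ R₀ : ℝ, ∀ z : EuclideanSpace ℝ (Fin 3), ∃ y : EuclideanSpace ℝ (Fin 3),
          μ {y} ≠ 0 ∧ dist z y ≤ R₀) := fun H =>
  not_cohesive_at_relaxed_threshold (lt_add_one eStar) fun δ hδ P hP hhc hst _ =>
    H δ hδ P hP hhc hst

/-! ## §5 The crux contains Palm-side stability -/

/-- **`MinimisingLawsCohesive` implies Palm-side stability**: `e* ≤ E_P[rootEnergy]` for every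
point-stationary, a.s. hard-core probability law `P` — otherwise the mixture with weight
`p = 1 - e*/E_P` of `δ_{δ_0}` is minimising and charges the one-point configuration. (The
inequality itself is true — hyperfinite exhaustion by a random grid + `card_mul_eStar_le` — but
not yet a tree theorem; this shows the crux cannot be cheaper than it.) [folklore] -/
theorem eStar_le_integral_of_minimisingLawsCohesive (H : MinimisingLawsCohesive) {δ : ℝ}
    (hδ : 0 < δ) (P : Measure (Measure (EuclideanSpace ℝ (Fin 3)))) [IsProbabilityMeasure P]
    (hhc : ∀ᵐ μ ∂P, IsRootedHardCore δ μ) (hst : IsPointStationaryLaw P) :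
    eStar ≤ ∫ μ, rootEnergy lennardJones μ ∂P := by
  by_contra hlt
  rw [not_le] at hlt
  set E₁ : ℝ := ∫ μ, rootEnergy lennardJones μ ∂P with hE₁
  have hes : eStar < 0 := by linarith [eStar_le_neg]
  have hE₁0 : E₁ < 0 := hlt.trans hes
  have hq0 : 0 < eStar / E₁ := div_pos_of_neg_of_neg hes hE₁0
  have hq1 : eStar / E₁ < 1 := (div_lt_one_of_neg hE₁0).2 hlt
  set p : ℝ≥0∞ := ENNReal.ofReal (1 - eStar / E₁) with hpdef
  have hp1 : p ≤ 1 := ENNReal.ofReal_le_one.2 (by linarith)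
  have hp0 : p ≠ 0 := (ENNReal.ofReal_pos.2 (by linarith)).ne'
  have htoReal : (1 - p).toReal = eStar / E₁ := by
    rw [ENNReal.toReal_sub_of_le hp1 ENNReal.one_ne_top, ENNReal.toReal_one, hpdef,
      ENNReal.toReal_ofReal (by linarith)]
    ring
  haveI := isProbabilityMeasure_mix P hp1
  refine not_ae_relDense_mix P hp0
    (H δ hδ _ inferInstance (ae_isRootedHardCore_mix hhc p) (isPointStationaryLaw_mix hst p) ?_)
  rw [integral_rootEnergy_mix, htoReal, ← hE₁, div_mul_cancel₀ _ hE₁0.ne]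
  exact le_rfl

/-- **The crux, split**: `MinimisingLawsCohesive` is EXACTLY the conjunction of Palm-side
stability (`e* ≤ E_P[rootEnergy]` over the whole frame) and cohesion of the laws whose mean root
energy is exactly `e*`. A counterexample must therefore sit exactly at `e*`. [folklore] -/
theorem minimisingLawsCohesive_iff_stable_and_exact :
    MinimisingLawsCohesive ↔
      (∀ δ : ℝ, 0 < δ → ∀ P : Measure (Measure (EuclideanSpace ℝ (Fin 3))),
          IsProbabilityMeasure P → (∀ᵐ μ ∂P, IsRootedHardCore δ μ) → IsPointStationaryLaw P →
          eStar ≤ ∫ μ, rootEnergy lennardJones μ ∂P) ∧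
      (∀ δ : ℝ, 0 < δ → ∀ P : Measure (Measure (EuclideanSpace ℝ (Fin 3))),
          IsProbabilityMeasure P → (∀ᵐ μ ∂P, IsRootedHardCore δ μ) → IsPointStationaryLaw P →
          (∫ μ, rootEnergy lennardJones μ ∂P) = eStar →
          ∀ᵐ μ ∂P, ∃ R₀ : ℝ, ∀ z : EuclideanSpace ℝ (Fin 3), ∃ y : EuclideanSpace ℝ (Fin 3),
            μ {y} ≠ 0 ∧ dist z y ≤ R₀) := by
  constructor
  · intro H
    refine ⟨fun δ hδ P hP hhc hst => ?_,
      fun δ hδ P hP hhc hst hE => H δ hδ P hP hhc hst hE.le⟩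
    haveI := hP
    exact eStar_le_integral_of_minimisingLawsCohesive H hδ P hhc hst
  · rintro ⟨hstab, hex⟩ δ hδ P hP hhc hst hE
    exact hex δ hδ P hP hhc hst (le_antisymm hE (hstab δ hδ P hP hhc hst))

end Summit.AtomisticToContinuum.Crystallization.Theorems.MinimisingLawsCohesive.Negative.OnePointMixtures

end
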